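import Literature.Computability.QuantumComplexity.KeyDiagonalAveraging
import Literature.Computability.QuantumComplexity.BQPProofs
import HarnessLib

/-!
# A Hadamard layer on a register that is afterwards kept classical AVERAGES the event probabilities over the register

Topic `Literature/Computability/QuantumComplexity`; sequel of `KeyDiagonalAveraging.lean` (`KeyDiagonal s U`: the
matrix `U` has no entries between basis states differing on the key wires `s : Fin κ ↪ Fin N`; for such `U` the
branches `|key⟩|rest⟩` do not interfere, `KeyDiagonal.sum_normSq_mulVec_sum`) and of the Hadamard-layer lemma
`hadamards_mulVec_basisState` of `BQPProofs.lean` (`H` on the distinct wires `ws`, applied to a basis state vanishing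
on `ws`, gives the uniform superposition with amplitude `2^{-|ws|/2}`; Nielsen–Chuang 2010, §1.4.4). Together:
"prepare a uniformly random key by Hadamards, then run a circuit that uses the key only classically" has, for every
measurement event, probability equal to the AVERAGE over the `2^κ` keys of the event probability of the circuit run on
the basis input carrying that key (principle of deferred measurement, Nielsen–Chuang 2010, §4.4; this is how a
quantum algorithm is run "on a random member `h_key` of a hash family" inside one circuit, Zhandry 2012, Thm. 3.1).

* `assignKey s w key` — the basis label `w` with `key` written on the key wires; `assignKey_comp`,
  `assignKey_of_not_mem_range`, `eq_assignKey_iff`;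
* `hadamards_ofFn_mulVec_basisState_eq_sum` — the Hadamard layer on the key wires, applied to `|w⟩` with the key
  wires of `w` reading `0`, yields `Σ_key 2^{-κ/2} |assignKey s w key⟩` (reindexing of `hadamards_mulVec_basisState`);
* **`sum_normSq_hadamards_then_keyDiagonal`** — for a gate list `body` whose matrix is `KeyDiagonal s` and every
  finite event `E`: the probability of `E` after `(H on the key wires) ++ body` run on `|w⟩` equals
  `2^{-κ} · Σ_key (probability of E after body run on |assignKey s w key⟩)`.

Everything here is PROVED; one definition (`assignKey`).

## References

* M. A. Nielsen, I. L. Chuang, *Quantum Computation and Quantum Information*, CUP 2010, §1.4.4 (`H^{⊗n}|0⟩`), §4.4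
  (deferred measurement, Exercise 4.35), §2.2.5 (Born rule) [NielsenChuang2010].
* M. Zhandry, *Secure identity-based encryption in the quantum random oracle model*, CRYPTO 2012 (arXiv:1204.0629),
  Thm. 3.1 (simulate a random oracle by a random member of a `2T`-wise independent family) [Zhandry2012].
-/

noncomputable section

namespace Literature.Computability.QuantumComplexity

open Cryptography Matrix Finset

variable {N κ : ℕ}

/-! ### Writing a key on the key wires -/

/-- The basis label `w` with `key` written on the key wires `s` (off the range of `s` it is `w`).
[cite: NielsenChuang2010, §4.4 (a classical control register)] -/
def assignKey (s : Fin κ ↪ Fin N) (w : QReg N) (key : QReg κ) : QReg N :=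
  fun i => if h : ∃ j, s j = i then key (Classical.choose h) else w i

/-- On the key wires, `assignKey` reads the key. [cite: NielsenChuang2010, §4.4] -/
theorem assignKey_comp (s : Fin κ ↪ Fin N) (w : QReg N) (key : QReg κ) : assignKey s w key ∘ s = key := by
  funext j
  have h : ∃ j', s j' = s j := ⟨j, rfl⟩
  simp only [Function.comp_apply, assignKey, dif_pos h]
  congr 1
  exact s.injective (Classical.choose_spec h)

/-- Off the key wires, `assignKey` reads `w`. [cite: NielsenChuang2010, §4.4] -/
theorem assignKey_of_not_mem_range (s : Fin κ ↪ Fin N) (w : QReg N) (key : QReg κ) {i : Fin N}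
    (hi : i ∉ Set.range s) : assignKey s w key i = w i := by
  have h : ¬ ∃ j, s j = i := fun ⟨j, hj⟩ => hi ⟨j, hj⟩
  simp only [assignKey, dif_neg h]

/-- A basis label is `assignKey s w key` iff it reads `key` on the key wires and agrees with `w` off them.
[cite: NielsenChuang2010, §4.4] -/
theorem eq_assignKey_iff (s : Fin κ ↪ Fin N) (w : QReg N) (key : QReg κ) (x : QReg N) :
    x = assignKey s w key ↔ x ∘ s = key ∧ ∀ i, i ∉ Set.range s → x i = w i := by
  constructor
  · rintro rfl
    exact ⟨assignKey_comp s w key, fun i hi => assignKey_of_not_mem_range s w key hi⟩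
  · rintro ⟨hk, hoff⟩
    funext i
    by_cases hi : i ∈ Set.range s
    · obtain ⟨j, rfl⟩ := hi
      have h1 : assignKey s w key (s j) = key j := congrFun (assignKey_comp s w key) j
      rw [h1, ← hk, Function.comp_apply]
    · rw [assignKey_of_not_mem_range s w key hi, hoff i hi]

/-! ### The Hadamard layer on the key wires as a sum over keys -/

/-- **The Hadamard layer writes the uniform superposition of keys**: `H` on the key wires `s 0, …, s (κ-1)`, applied
to `|w⟩` with `w` reading `0` on the key wires, gives `Σ_key 2^{-κ/2} · |assignKey s w key⟩`.
[cite: NielsenChuang2010, §1.4.4 (H^{⊗n}|0⟩ is the uniform superposition)] -/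
theorem hadamards_ofFn_mulVec_basisState_eq_sum (s : Fin κ ↪ Fin N) (w : QReg N) (hw : ∀ j, w (s j) = false) :
    (⟨(List.ofFn s).map hOn⟩ : QCircuit cliffordT N).toMatrix 0 *ᵥ basisState w =
      fun x => ∑ key : QReg κ, invSqrt2 ^ κ * basisState (assignKey s w key) x := by
  classical
  have hnd : (List.ofFn s).Nodup := List.nodup_ofFn.mpr s.injective
  have hw' : ∀ i ∈ List.ofFn s, w i = false := by
    intro i hi
    obtain ⟨j, rfl⟩ := (List.mem_ofFn' s i).1 hi
    exact hw j
  rw [hadamards_mulVec_basisState _ hnd w hw', List.length_ofFn]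
  funext x
  have hmem : ∀ i : Fin N, i ∉ List.ofFn s ↔ i ∉ Set.range s := fun i => by
    rw [List.mem_ofFn']
  by_cases hx : ∀ i, i ∉ List.ofFn s → x i = w i
  · rw [if_pos hx, Finset.sum_eq_single (x ∘ s)]
    · have hxe : x = assignKey s w (x ∘ s) :=
        (eq_assignKey_iff s w (x ∘ s) x).2 ⟨rfl, fun i hi => hx i ((hmem i).2 hi)⟩
      rw [basisState_apply, if_pos hxe, mul_one]
    · intro key _ hkey
      rw [basisState_apply, if_neg, mul_zero]
      intro hxe
      exact hkey ((eq_assignKey_iff s w key x).1 hxe).1.symm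
    · intro h
      exact absurd (Finset.mem_univ _) h
  · rw [if_neg hx]
    symm
    refine Finset.sum_eq_zero fun key _ => ?_
    rw [basisState_apply, if_neg, mul_zero]
    intro hxe
    exact hx fun i hi => ((eq_assignKey_iff s w key x).1 hxe).2 i ((hmem i).1 hi)

/-- The Hadamard layer is oracle-free, so its matrix does not depend on the oracle. [folklore] -/
private theorem toMatrix_hadamards_ofFn (s : Fin κ ↪ Fin N) (A : Language Bool) :
    (⟨(List.ofFn s).map hOn⟩ : QCircuit cliffordT N).toMatrix A =
      (⟨(List.ofFn s).map hOn⟩ : QCircuit cliffordT N).toMatrix 0 := by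
  refine QCircuit.toMatrix_eq_of_isOracleFree (fun g hg => ?_) A 0
  obtain ⟨i, -, rfl⟩ := List.mem_map.1 hg
  exact hOn_isOracleFree i

/-! ### The averaging theorem -/

/-- **Hadamards on a register kept classical average the event probabilities.** Let `body` be a gate list whose
matrix (oracle `A`) is `KeyDiagonal s`, and let `w` read `0` on the key wires. Then for every finite event `E` the
Born probability of `E` after running `(H on the key wires) ++ body` on `|w⟩` is `2^{-κ}` times the sum over the keys
of the probability of `E` after running `body` on `|assignKey s w key⟩`.
[cite: NielsenChuang2010, §4.4 (principle of deferred measurement)] [cite: Zhandry2012, Thm. 3.1 (run on a random member of the family)] -/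
theorem sum_normSq_hadamards_then_keyDiagonal (s : Fin κ ↪ Fin N) (body : List (QGate cliffordT N))
    (A : Language Bool) (hbody : KeyDiagonal s ((⟨body⟩ : QCircuit cliffordT N).toMatrix A))
    (w : QReg N) (hw : ∀ j, w (s j) = false) (E : Finset (QReg N)) :
    ∑ y ∈ E, ‖((⟨(List.ofFn s).map hOn ++ body⟩ : QCircuit cliffordT N).toMatrix A *ᵥ basisState w) y‖ ^ 2 =
      (1 / 2 : ℝ) ^ κ *
        ∑ key : QReg κ, ∑ y ∈ E, ‖((⟨body⟩ : QCircuit cliffordT N).toMatrix A *ᵥ basisState (assignKey s w key)) y‖ ^ 2 := by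
  have happ : (⟨(List.ofFn s).map hOn ++ body⟩ : QCircuit cliffordT N) =
      (⟨(List.ofFn s).map hOn⟩ : QCircuit cliffordT N).append ⟨body⟩ := rfl
  rw [happ, QCircuit.toMatrix_append, ← Matrix.mulVec_mulVec, toMatrix_hadamards_ofFn,
    hadamards_ofFn_mulVec_basisState_eq_sum s w hw,
    KeyDiagonal.sum_normSq_mulVec_sum hbody (assignKey s w) (assignKey_comp s w) (invSqrt2 ^ κ) E,
    norm_invSqrt2_pow_sq]

end Literature.Computability.QuantumComplexity

end
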